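import Summits.QuantumFields.YangMills.Theorems.UV3PinnedRatioOfTowerBounds
import HarnessLib

/-!
# (Z-DOOR-ANCHORED) — THE MULTIPLICATIVE TWIN OF THE Z-DOOR: GIBBS PROBABILITY OF A HISTORY EVENT FROM AN ANCHORED POINTWISE BOUND ON THE
# PINNED TOWER AND AN ANCHORED LOWER BOUND ON THE PARTITION INTEGRAL — NO LOGARITHM, THE ANCHOR `Λ = 0` CASE FOLDED IN

Cell `ym3-torus` (YM ladder rung R3 = continuum `SU(2)` Yang–Mills on the three-torus — a RUNG, NOT d = 4, NOT infinite volume, NOT a mass gap,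
NOT Clay).  Width seat `ym3-torus-px12` (gen 12; p1-lineage purpose = the UV3 node of [Balaban1985UV3]); `--supports stmt-QuantumFields-19936 --as helper`,
count-neutral, definition-free, default heartbeats.  Spec = `ym3-torus-px13` g11's second row for this seat (bus 2026-08-29 20:39:39Z «px12: (Z-DOOR-ANCHORED)»),
over px13's Z-DOOR v2.1 ✓`Summit.QuantumFields.YangMills.Theorems.UV3PinnedRatioOfTowerBounds` (§1 weighted push-forward `integral_pinnedTower_eq`, (6)
`integral_emlDensity_eq_partitionFn`, `measurableSet_histEvent`, `integrable_pinnedTower` — all used BY NAME).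

THE POINT.  The Z-DOOR (§2∕§3 of px13's file) reads its two Z-level slots in the ADDITIVE vacuum-energy currency of print ((41)∕(47): `exp(−E ± C)`).
The S-step ∕ S-low TEXTS of the «pinned (41)» plan (`SSTEP-SLOW-TEXTS-px13g11.md` §1–§2) are ANCHORED MULTIPLICATIVELY at a shared `Λ ≥ 0` (the tree's
`emlDensity` tower carries `E = 0`, so print's `e^{−E_K}` is replaced by a version-independent anchor — px13 g11 v2.1: existential, or `essSup ρ_K`;
NOT the point value `ρ_K(1)` of a Radon–Nikodym version), and an anchor may vanish.  This file is the log-free twin the texts dock into: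
* ★★ `gibbsK_real_histEvent_le_of_anchoredBounds` — for measurable weight sets `C i`, the pinned tower `σ` of `C` up to height `j`, a level `k ∈ [j, K]`,
  an anchor `Λ ≥ 0`, `Cu ≥ 0`, `cl > 0`, `w ≥ 0`:  (UP) `σ_k ≤ Λ·Cu·w` `dV_k`-a.e.  ∧  (LOW) `Λ·cl ≤ ∫ ρ_k dV_k`  ⟹  `Gibbs_K{∀ i ≤ j, Ū^i U ∈ C i} ≤ (Cu∕cl)·w`
  (if `Λ = 0` the numerator `∫σ_k ≤ 0` forces probability `0`; else divide — no `exp`∕`log`);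
* ★★ `gibbsK_real_pinnedConditioned_le_of_anchoredBounds` — the same at `hP`'s event (`PlanPinned41.stub_pinnedRatio` v1.1 = LEAD's K-19 `hP`): plaquette `a`
  of `Ū^jU` (7)-large, every finer averaged field (7)-small — measured set token for token as in px13's §3.

HONEST SCOPE.  Measure-theoretic bookkeeping over the constructed tower (a ratio of two integrals); (UP) = S-step's output slot and (LOW) = S-low's slot are
DISPLAYED hypotheses, asserted for nothing; nothing of (Z-UP-PIN), (Z-LOW), S-step, `stub_pinnedRatio`, `HistoryTailL` (19936), K1, (Q), the UV3 node's
tiers or the rung is proved here.  Sorry-free, axioms standard.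

References: T. Bałaban, *Ultraviolet stability of three-dimensional lattice pure gauge field theories*, Commun. Math. Phys. **102** (1985) 255–275
[Balaban1985UV3] ((2), (5) p.256; (6)–(8) pp.257–258; (41) p.266; (47) p.267; (71) p.273).
-/

set_option autoImplicit false

noncomputable section

namespace Summit.QuantumFields.YangMills.Theorems.UV3PinnedRatioOfTowerBoundsAnchored

open MeasureTheory
open Literature.MathematicalPhysics.QuantumFieldTheory.Balaban1983to89
open Literature.MathematicalPhysics.QuantumFieldTheory.Balaban1983to89.T3ContinuumYM3Torus
open Literature.MathematicalPhysics.QuantumFieldTheory.Balaban1983to89.Missing (boltzmann partitionFn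
  isProbabilityMeasure_fieldMeasure partitionFn_pos')
open Literature.MathematicalPhysics.QuantumFieldTheory.Balaban1983to89.T3UnitLawDensityEML (ℰp emlDensity rt emlDensity_zero)
open Literature.MathematicalPhysics.QuantumFieldTheory.Balaban1983to89.T3UnitScaleTilt (gibbsK gibbsK_eq θBal)
open Summit.QuantumFields.YangMills.Theorems.UV3PinnedRatioOfTowerBounds (measurableSet_histEvent integrable_pinnedTower
  integral_pinnedTower_eq integral_emlDensity_eq_partitionFn)

variable (F : T3Family) {γ : ℝ} (K : ℕ)

/-! ## §1 THE ANCHORED DOOR — history events -/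

/-- ★★ **THE (Z-DOOR), MULTIPLICATIVE∕ANCHORED FORM.**  Let `C i` be measurable weight sets of level-`i` fields of the `K`-th approximation (`0 ≤ γ`),
`j ≤ k ≤ K`, `σ` the pinned tower of `C` up to height `j` (free transport after), an anchor `Λ ≥ 0` and reals `Cu ≥ 0`, `cl > 0`, `w ≥ 0`.  IF (UP)
`σ_k ≤ Λ·Cu·w` `dV_k`-A.E. at level `k` (a.e., not pointwise: the tower is a Radon–Nikodym version — px13 g11 v2.1) and (LOW) `Λ·cl ≤ ∫ ρ_k dV_k` (the SAME anchor: it cancels), THEN `Gibbs_K{U | ∀ i ≤ j, Ū^i U ∈ C i} ≤ (Cu∕cl)·w`.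
Proof: the Gibbs probability is `(∫ ρ₀·𝟙{history})∕Z_K` (lit `integral_gibbsMeasure`), the numerator is `∫ σ_k ≤ Λ·Cu·w` (px13's `integral_pinnedTower_eq`
+ Haar mass `1`), `Z_K = ∫ ρ_k ≥ Λ·cl` ((6)); if `Λ = 0` the numerator is `≤ 0`, else divide.  No vacuum-energy letter, no logarithm.
[cite: Balaban1985UV3, (2) p.256, (6)–(8) pp.257–258, (41) p.266, (47) p.267] -/
theorem gibbsK_real_histEvent_le_of_anchoredBounds (hγ : 0 ≤ γ)
    (C : (i : ℕ) → Set (GaugeField (F.P K) i (Matrix.specialUnitaryGroup (Fin 2) ℂ))) (hC : ∀ i, MeasurableSet (C i))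
    {j : ℕ} (σ : (k : ℕ) → Density (F.P K) k (Matrix.specialUnitaryGroup (Fin 2) ℂ))
    (hσ0 : σ 0 = (C 0).indicator (emlDensity F γ K 0))
    (hσw : ∀ (i : ℕ) (h : i + 1 ≤ F.m + K), i + 1 ≤ j → σ (i + 1) = (C (i + 1)).indicator ((rt F K i h).T (σ i)))
    (hσf : ∀ (i : ℕ) (h : i + 1 ≤ F.m + K), j ≤ i → σ (i + 1) = (rt F K i h).T (σ i))
    {k : ℕ} (hjk : j ≤ k) (hkK : k ≤ K) {Λ Cu cl w : ℝ} (hΛ : 0 ≤ Λ) (hCu : 0 ≤ Cu) (hcl : 0 < cl) (hw : 0 ≤ w)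
    (hUP : ∀ᵐ V ∂fieldMeasure (F.P K) k (Matrix.specialUnitaryGroup (Fin 2) ℂ), σ k V ≤ Λ * Cu * w)
    (hLOW : Λ * cl ≤ ∫ V, emlDensity F γ K k V ∂fieldMeasure (F.P K) k (Matrix.specialUnitaryGroup (Fin 2) ℂ)) :
    (gibbsK F ℰp γ K).real
        {U : GaugeField (F.P K) 0 (Matrix.specialUnitaryGroup (Fin 2) ℂ) |
          ∀ i, i ≤ j → Averaging.iter (fun i' => BlockAveraging.blockAvg (P := F.P K) (j := i') ℰp) i U ∈ C i}
      ≤ Cu / cl * w := by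
  have hkm : k ≤ F.m + K := by omega
  haveI := isProbabilityMeasure_fieldMeasure (G := Matrix.specialUnitaryGroup (Fin 2) ℂ) (F.P K) k
  set S := {U : GaugeField (F.P K) 0 (Matrix.specialUnitaryGroup (Fin 2) ℂ) |
      ∀ i, i ≤ j → Averaging.iter (fun i' => BlockAveraging.blockAvg (P := F.P K) (j := i') ℰp) i U ∈ C i} with hS
  have hSm : MeasurableSet S := measurableSet_histEvent F K C hC j
  set Z : ℝ := partitionFn (G := Matrix.specialUnitaryGroup (Fin 2) ℂ) (F.P K) ((F.scheme ℰp γ).β K) with hZdef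
  have hZpos : 0 < Z := partitionFn_pos' (G := Matrix.specialUnitaryGroup (Fin 2) ℂ) (F.P K) (F.scheme_β_nonneg ℰp hγ K)
  -- the Gibbs probability as a ratio of Z-level integrals
  have hratio : (gibbsK F ℰp γ K).real S =
      (∫ U, S.indicator 1 U * boltzmann (F.P K) ((F.scheme ℰp γ).β K) U
          ∂fieldMeasure (F.P K) 0 (Matrix.specialUnitaryGroup (Fin 2) ℂ)) / Z := by
    rw [← integral_indicator_one hSm, gibbsK_eq, T4GenFunBounds.integral_gibbsMeasure _ (F.scheme_β_nonneg ℰp hγ K)]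
  -- numerator = the pinned tower's mass at level k ≤ Λ·Cu·w
  have hnum : ∫ U, S.indicator 1 U * boltzmann (F.P K) ((F.scheme ℰp γ).β K) U
      ∂fieldMeasure (F.P K) 0 (Matrix.specialUnitaryGroup (Fin 2) ℂ) ≤ Λ * Cu * w := by
    have hmass := integral_pinnedTower_eq F K hγ C hC j σ hσ0 hσw hσf k hjk hkm
    have hcomm : ∫ U, S.indicator 1 U * boltzmann (F.P K) ((F.scheme ℰp γ).β K) U
        ∂fieldMeasure (F.P K) 0 (Matrix.specialUnitaryGroup (Fin 2) ℂ) =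
        ∫ V, σ k V ∂fieldMeasure (F.P K) k (Matrix.specialUnitaryGroup (Fin 2) ℂ) := by
      rw [hmass]
      refine integral_congr_ae (Filter.Eventually.of_forall fun U => ?_)
      show S.indicator 1 U * boltzmann (F.P K) ((F.scheme ℰp γ).β K) U = emlDensity F γ K 0 U * S.indicator 1 U
      rw [emlDensity_zero, mul_comm]
    rw [hcomm]
    have hint := integrable_pinnedTower F K hγ C hC j σ hσ0 hσw hσf k hkm
    calc ∫ V, σ k V ∂fieldMeasure (F.P K) k (Matrix.specialUnitaryGroup (Fin 2) ℂ)
        ≤ ∫ _V, Λ * Cu * w ∂fieldMeasure (F.P K) k (Matrix.specialUnitaryGroup (Fin 2) ℂ) :=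
          integral_mono_ae hint (integrable_const _) hUP
      _ = Λ * Cu * w := by rw [integral_const, smul_eq_mul, probReal_univ, one_mul]
  -- denominator: Z_K = ∫ ρ_k ≥ Λ·cl
  have hden : Λ * cl ≤ Z := by
    rw [hZdef, ← integral_emlDensity_eq_partitionFn F K hγ k hkm]
    exact hLOW
  have hgoal : 0 ≤ Cu / cl * w := mul_nonneg (div_nonneg hCu hcl.le) hw
  rw [hratio, div_le_iff₀ hZpos]
  rcases hΛ.eq_or_lt with hΛ0 | hΛpos
  · -- the anchor vanishes: the numerator is ≤ 0
    have h0 : Λ * Cu * w = 0 := by rw [← hΛ0]; ring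
    calc ∫ U, S.indicator 1 U * boltzmann (F.P K) ((F.scheme ℰp γ).β K) U
          ∂fieldMeasure (F.P K) 0 (Matrix.specialUnitaryGroup (Fin 2) ℂ) ≤ 0 := by rw [← h0]; exact hnum
      _ ≤ Cu / cl * w * Z := mul_nonneg hgoal hZpos.le
  · -- divide: Λ·Cu·w = (Cu/cl·w)·(Λ·cl) ≤ (Cu/cl·w)·Z
    have h1 : Λ * Cu * w = Cu / cl * w * (Λ * cl) := by
      field_simp
    have h2 : Cu / cl * w * (Λ * cl) ≤ Cu / cl * w * Z := mul_le_mul_of_nonneg_left hden hgoal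
    linarith [hnum, h1, h2]

/-! ## §2 THE ANCHORED DOOR at `hP`'s event: plaquette `a` of `Ū^j U` (7)-large, all finer levels (7)-small -/

/-- ★★ **THE ANCHORED (Z-DOOR) AT THE EVENT OF `PlanPinned41.stub_pinnedRatio` v1.1 = LEAD's K-19 `hP`.**  For the `K`-th approximation (`0 ≤ γ`), a height
`j ≤ K`, a plaquette `a` of the level-`j` torus, profile parameters `b₀ p₀`, and weight sets `C` with `C i = {PlaqSmall (θBal F.L γ b₀ p₀ (K − i))}` for
`i < j` (the CONDITIONER) and `C j = {V | θBal F.L γ b₀ p₀ (K − j) ≤ dist1 (V(∂a))}` (the PIN): IF the pinned tower `σ` of `C` obeys (UP) `σ_k ≤ Λ·Cu·w`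
`dV_k`-a.e. at a level `k ∈ [j, K]` and (LOW) `Λ·cl ≤ ∫ ρ_k dV_k` with the SAME anchor `Λ ≥ 0` (`Cu ≥ 0`, `cl > 0`, `w ≥ 0`), THEN — token for token the measured
set of `hP` — `(gibbsK F ℰp γ K).real ({U | θBal … (K − j) ≤ dist1 (plaqHol (Ū^j U) a)} ∩ {U | ∀ i, i < j → PlaqSmall (θBal … (K − i)) (Ū^i U)}) ≤ (Cu∕cl)·w`.
Instantiate `w := β_{K−j}^A·exp(−c·p(g_{K−j})²)` and a VERSION-INDEPENDENT anchor `Λ` (px13 g11 v2.1: an existential shared anchor, or `essSup ρ_K`;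
NOT a point value of the Radon–Nikodym version) for the S-step∕S-low texts; neither slot is proved here.
[cite: Balaban1985UV3, (2) p.256, (5) p.256, (6)–(8) pp.257–258, (41) p.266, (47) p.267, (71) p.273] -/
theorem gibbsK_real_pinnedConditioned_le_of_anchoredBounds (hγ : 0 ≤ γ) (b₀ p₀ : ℝ) {j : ℕ} (a : Plaq (F.P K) j)
    (C : (i : ℕ) → Set (GaugeField (F.P K) i (Matrix.specialUnitaryGroup (Fin 2) ℂ))) (hC : ∀ i, MeasurableSet (C i))
    (hClt : ∀ i, i < j → C i = {V | PlaqSmall (θBal F.L γ b₀ p₀ (K - i)) V})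
    (hCj : C j = {V | θBal F.L γ b₀ p₀ (K - j) ≤ GaugeGroup.dist1 (GaugeField.plaqHol V a)})
    (σ : (k : ℕ) → Density (F.P K) k (Matrix.specialUnitaryGroup (Fin 2) ℂ))
    (hσ0 : σ 0 = (C 0).indicator (emlDensity F γ K 0))
    (hσw : ∀ (i : ℕ) (h : i + 1 ≤ F.m + K), i + 1 ≤ j → σ (i + 1) = (C (i + 1)).indicator ((rt F K i h).T (σ i)))
    (hσf : ∀ (i : ℕ) (h : i + 1 ≤ F.m + K), j ≤ i → σ (i + 1) = (rt F K i h).T (σ i))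
    {k : ℕ} (hjk : j ≤ k) (hkK : k ≤ K) {Λ Cu cl w : ℝ} (hΛ : 0 ≤ Λ) (hCu : 0 ≤ Cu) (hcl : 0 < cl) (hw : 0 ≤ w)
    (hUP : ∀ᵐ V ∂fieldMeasure (F.P K) k (Matrix.specialUnitaryGroup (Fin 2) ℂ), σ k V ≤ Λ * Cu * w)
    (hLOW : Λ * cl ≤ ∫ V, emlDensity F γ K k V ∂fieldMeasure (F.P K) k (Matrix.specialUnitaryGroup (Fin 2) ℂ)) :
    (gibbsK F ℰp γ K).real
        ({U : GaugeField (F.P K) 0 (Matrix.specialUnitaryGroup (Fin 2) ℂ) |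
            θBal F.L γ b₀ p₀ (K - j) ≤ GaugeGroup.dist1 (GaugeField.plaqHol
              (Averaging.iter (fun i' => BlockAveraging.blockAvg (P := F.P K) (j := i') ℰp) j U) a)} ∩
          {U : GaugeField (F.P K) 0 (Matrix.specialUnitaryGroup (Fin 2) ℂ) | ∀ i, i < j →
            PlaqSmall (θBal F.L γ b₀ p₀ (K - i))
              (Averaging.iter (fun i' => BlockAveraging.blockAvg (P := F.P K) (j := i') ℰp) i U)})
      ≤ Cu / cl * w := by
  have hev : ({U : GaugeField (F.P K) 0 (Matrix.specialUnitaryGroup (Fin 2) ℂ) |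
            θBal F.L γ b₀ p₀ (K - j) ≤ GaugeGroup.dist1 (GaugeField.plaqHol
              (Averaging.iter (fun i' => BlockAveraging.blockAvg (P := F.P K) (j := i') ℰp) j U) a)} ∩
          {U : GaugeField (F.P K) 0 (Matrix.specialUnitaryGroup (Fin 2) ℂ) | ∀ i, i < j →
            PlaqSmall (θBal F.L γ b₀ p₀ (K - i))
              (Averaging.iter (fun i' => BlockAveraging.blockAvg (P := F.P K) (j := i') ℰp) i U)}) =
      {U : GaugeField (F.P K) 0 (Matrix.specialUnitaryGroup (Fin 2) ℂ) |
          ∀ i, i ≤ j → Averaging.iter (fun i' => BlockAveraging.blockAvg (P := F.P K) (j := i') ℰp) i U ∈ C i} := by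
    ext U
    simp only [Set.mem_inter_iff, Set.mem_setOf_eq]
    constructor
    · rintro ⟨hlarge, hsmall⟩ i hi
      rcases Nat.lt_or_eq_of_le hi with hlt | heq
      · rw [hClt i hlt]; exact hsmall i hlt
      · subst heq; rw [hCj]; exact hlarge
    · intro h
      refine ⟨?_, fun i hi => ?_⟩
      · have hj := h j le_rfl
        rw [hCj] at hj
        exact hj
      · have hi' := h i hi.le
        rw [hClt i hi] at hi'
        exact hi'
  rw [hev]
  exact gibbsK_real_histEvent_le_of_anchoredBounds F K hγ C hC σ hσ0 hσw hσf hjk hkK hΛ hCu hcl hw hUP hLOW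

end Summit.QuantumFields.YangMills.Theorems.UV3PinnedRatioOfTowerBoundsAnchored

end
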